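/-
Copyright (c) 2026 the pub-hodgecm-mathlib formalisation cell (harness21).  Prover seat hodgecm-mathlib-LH4-p12 (g7), req620 Track A «(D-RAM) FOUR-FRAME», line LH4
(STAGE-1b tier-0 regular row, (L-sq) producer (S2b-T) «THE LABELLED TRUNK», rotated glued part OFF the cancellation locus: the labelled type-0 κ-sockets G2 and G3 off the locus =
★ p859787's labelled rotations fed with ★ p859714's labelled G1; dealer LH4-plan (g13) WORD #58 RULING C «YOU on G1-sep∕G2»).  2026-09-04.
-/
import Summits.HodgeConjecture.HodgeConjecture.Theorems.F0P3cDyRamLabelledKappaGluedSocketsOffLocus   -- ★ p859714 (this seat): labelled κ-G1 ∕ κ-H off the locus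
import Summits.HodgeConjecture.HodgeConjecture.Theorems.F0P3cDyRamLabelledKappaStrataPermutation     -- ★ p859787 (this seat): `…_stratum_G2∕G3_sep_latticeInLevel_of_G1`
import Summits.HodgeConjecture.HodgeConjecture.Theorems.F0P3cDyRamDiagonalKappaGluedRotations        -- ★ (LH4-p09 (g3)): `vec3_swap01`, `vec3_swap02` (and the unlabelled G2∕G3 for comparison)
import HarnessLib

/-!
# Crux `H413`, line LH4 «(D-RAM) FOUR-FRAME» — (S2b-T), rotated glued part off the cancellation locus: THE LABELLED TYPE-0 κ-SOCKETS G2 AND G3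

★ p859714 `finsum_kappaCount_mul_stabiliserWeight_stratum_G1_sep_latticeInLevel_of_ne` is the labelled κ-G1 socket off the cancellation locus for a GENERIC label vector `e`;
★ p859787 transports any labelled G1 statement to the rotated families, permuting the datum, the slot AND the label vector.  Composing the two gives the labelled κ-sockets on
G2 `(2ρ+s, 2ρ, 2ρ+s)` (swap `(0 1)`: datum `(β, α; n₂, n₁, n₃)`, glue witness of foot 1, label `(e₁, e₀, e₂)`, locus `|e₂ − e₀| = |e₂ − e₁|·|ϖ|^s`) and on G3 `(2ρ+s, 2ρ+s, 2ρ)`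
(swap `(0 2)` + rescaling: datum `(α⁻¹, βα⁻¹; n₃, n₂, n₁)`, glue witness of foot 2 with `(βα⁻¹−1)∕(α⁻¹−1) = (β−α)∕(1−α)`, label `(e₂, e₁, e₀)`, locus `|e₀ − e₁| = |e₀ − e₂|·|ϖ|^s`),
OFF their loci — the ★ unlabelled rotated sockets `finsum_kappaCount_mul_stabiliserWeight_hasAxis_G2∕G3` times the rotated constant label indicator.

* `finsum_kappaCount_mul_stabiliserWeight_stratum_G2_sep_latticeInLevel_of_ne`
* `finsum_kappaCount_mul_stabiliserWeight_stratum_G3_sep_latticeInLevel_of_ne`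

HONEST LABEL: helper lane (`--supports stmt-HodgeConjecture-24833`), count-neutral; two per-stratum census identities; pays no tier-0 row by itself (T₊∕T₋∕reg OPEN; the labelled
trunk stays OPEN: on-locus cells (LH4-p09 (g8)) and the labelled κ-box-sum outstanding); HC_CM is proved only modulo the 7 printed citations (2 remaining named inputs: hLiu418 =
stmt-HodgeConjecture-24832, h413 = stmt-HodgeConjecture-24833) until rung 0 closes.

## References (NEVER `[KR2]`)
* [Kottwitz1986BaseChangeUnits] R. E. Kottwitz, *Base change for unit elements of Hecke algebras*, Compositio Math. 60 (1986), §1 pp. 240–241.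
* [Rogawski1990] J. D. Rogawski, *Automorphic Representations of Unitary Groups in Three Variables*, Ann. of Math. Stud. 123 (1990), §4.9 Prop. 4.9.1 (a) p. 55, §4.10 p. 58.
* [LanglandsShelstad1987] R. P. Langlands, D. Shelstad, *On the definition of transfer factors*, Math. Ann. 278 (1987), §3.
-/

set_option autoImplicit false

noncomputable section

namespace Summit.HodgeConjecture.HodgeConjecture.Cruxes.H413.F0P3cDyRamLabelledKappaGluedRotationsOffLocus

open Matrix
open Literature.NumberTheory.Automorphic Literature.NumberTheory.Automorphic.HermitianLattice
open Literature.NumberTheory.Automorphic.UnitaryLatticeTree Literature.NumberTheory.Automorphic.UnitaryThreeFourFrame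
open Literature.NumberTheory.LocalFields Literature.NumberTheory.LocalFields.WildQuadraticDatum
open Summit.HodgeConjecture.HodgeConjecture.Cruxes.H413.F0P3cDyRamDiagonalTorusDefs
open Summit.HodgeConjecture.HodgeConjecture.Cruxes.H413.F0P3cDyRamDiagonalStrataDefs
open Summit.HodgeConjecture.HodgeConjecture.Cruxes.H413.F0P3cDyRamDiagonalKappaCountDefs
open Summit.HodgeConjecture.HodgeConjecture.Cruxes.H413.F0P3cDyRamFourFrameCensusDefs
open Summit.HodgeConjecture.HodgeConjecture.Cruxes.H413.F0P3cDyRamDiagonalKappaGluedRotations (vec3_swap01 vec3_swap02)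
open Summit.HodgeConjecture.HodgeConjecture.Cruxes.H413.F0P3cDyRamLabelledKappaGluedSocketsOffLocus
open Summit.HodgeConjecture.HodgeConjecture.Cruxes.H413.F0P3cDyRamLabelledKappaStrataPermutation
open scoped Valued WithZero Matrix MatrixGroups

variable {K : Type} [Field K] [Valued K ℤᵐ⁰] [CompleteSpace K] [Fintype 𝓀[K]] {σ : K →+* K} {ϖ : K} {d t : ℕ} {α β : K} {N₀ n₁ n₂ n₃ : ℕ}
  {T : GL (Fin 3) K}

/-- **LABELLED κ-G2 `(2ρ+s, 2ρ, 2ρ+s)` OFF THE CANCELLATION LOCUS** (`ρ, s ≥ 1`; a σ-fixed glue witness `f` of foot 1 as in ★ `finsum_kappaCount_mul_stabiliserWeight_hasAxis_G2`;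
`|e₂ − e₀| ≠ |e₂ − e₁|·|ϖ|^s`): the ★ unlabelled κ-G2 closed form if the rotated constant label condition
`(|e₁|, |e₀|, |e₂| ≤ |ϖ|^ℓ) ∧ |e₀ − e₁| ≤ |ϖ|^{ℓ+ρ} ∧ |e₂ − e₀| ≤ |ϖ|^{ℓ+ρ+s} ∧ (|e₂ − e₀| ≤ |ϖ|^{ℓ+2ρ+s} ∧ |e₂ − e₁|·|ϖ|^s ≤ |ϖ|^{ℓ+2ρ+s})` holds, else `0` — ★ p859787
`…_stratum_G2_sep_latticeInLevel_of_G1` ∘ ★ p859714 G1. [cite: Kottwitz1986BaseChangeUnits, §1 pp. 240–241] [cite: Rogawski1990, §4.9 Prop. 4.9.1 (a) p. 55; §4.10 p. 58]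
[cite: LanglandsShelstad1987, §3] -/
theorem finsum_kappaCount_mul_stabiliserWeight_stratum_G2_sep_latticeInLevel_of_ne (hD : IsRamifiedQuadraticDatum σ ϖ d t) (h2 : Valued.v (2 : K) < 1)
    (hE : IsElementDatum σ ϖ N₀ α β n₁ n₂ n₃) (hN₀ : d ≤ N₀) (hT : (T : Matrix (Fin 3) (Fin 3) K) = Matrix.diagonal ![α, β, 1])
    (ρ s : ℕ) (hρ : 1 ≤ ρ) (hs : 1 ≤ s) (i : Fin 3) (f : K) (hf : σ f = f)
    (hglue : 2 ∣ s → n₁ = n₃ → n₂ = n₁ + s → n₁ < 2 * ρ → 2 * ρ - n₁ ≤ n₁ - d + 1 → Valued.v (f + (α - 1) / (β - 1)) ≤ Valued.v ϖ ^ (2 * ρ + s - n₁))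
    (ℓ : ℕ) (e : Fin 3 → K) (hne : Valued.v (e 2 - e 0) ≠ Valued.v (e 2 - e 1) * Valued.v ϖ ^ s) :
    ∑ᶠ M ∈ {M | M ∈ stratum σ ϖ T ![2 * ρ + s, 2 * ρ, 2 * ρ + s] ∧ LatticeInLevel ϖ ℓ (Matrix.diagonal e) M},
        (kappaCount σ ϖ 0 i M : ℚ) * stabiliserWeight σ M =
      if ((Valued.v (e 1) ≤ Valued.v ϖ ^ ℓ ∧ Valued.v (e 0) ≤ Valued.v ϖ ^ ℓ ∧ Valued.v (e 2) ≤ Valued.v ϖ ^ ℓ) ∧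
          Valued.v (e 0 - e 1) ≤ Valued.v ϖ ^ (ℓ + ρ) ∧ Valued.v (e 2 - e 0) ≤ Valued.v ϖ ^ (ℓ + ρ + s) ∧
            (Valued.v (e 2 - e 0) ≤ Valued.v ϖ ^ (ℓ + 2 * ρ + s) ∧ Valued.v (e 2 - e 1) * Valued.v ϖ ^ s ≤ Valued.v ϖ ^ (ℓ + 2 * ρ + s))) then
        ((if 2 ∣ s ∧ 2 * ρ ≤ min n₁ n₃ ∧ 2 * ρ + s ≤ n₂ then
            (![0, (normSign σ (-1 : K) : ℚ) * (Fintype.card 𝓀[K] : ℚ) ^ (2 * ρ + s / 2 - 1) *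
                ((if 2 * d ≤ s then (Fintype.card 𝓀[K] : ℚ) - 1 else 0) - (if s + 2 = 2 * d then 1 else 0)), 0] : Fin 3 → ℚ) i
          else 0) +
        (if 2 ∣ s ∧ n₁ = n₃ ∧ n₂ = n₁ + s ∧ n₁ < 2 * ρ ∧ 2 * ρ - n₁ ≤ n₁ - d + 1 then
            (![if d ≤ (2 * ρ - n₁ + 1) / 2 then (normSign σ (-1 : K) : ℚ) * normSign σ f * normSign σ (1 + f) else 0,
               if 2 * d ≤ s + 2 * ((2 * ρ - n₁ + 1) / 2) then (normSign σ (-1 : K) : ℚ) * normSign σ (1 + f) else 0,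
               if d ≤ (2 * ρ - n₁ + 1) / 2 then (normSign σ f : ℚ) else 0] : Fin 3 → ℚ) i *
              (Fintype.card 𝓀[K] : ℚ) ^ (2 * ρ + s / 2 - (2 * ρ - n₁ + 1) / 2)
          else 0))
      else 0 := by
  have key := finsum_kappaCount_mul_stabiliserWeight_stratum_G2_sep_latticeInLevel_of_G1 hE hT ρ s ℓ
    (fun α' β' n₁' n₂' n₃' e' => (2 ∣ s → n₂' = n₃' → n₁' = n₂' + s → n₂' < 2 * ρ → 2 * ρ - n₂' ≤ n₂' - d + 1 →
        Valued.v (f + (β' - 1) / (α' - 1)) ≤ Valued.v ϖ ^ (2 * ρ + s - n₂')) ∧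
      Valued.v (e' 2 - e' 1) ≠ Valued.v (e' 2 - e' 0) * Valued.v ϖ ^ s)
    (fun _ _ n₁' n₂' n₃' e' j =>
      if ((Valued.v (e' 0) ≤ Valued.v ϖ ^ ℓ ∧ Valued.v (e' 1) ≤ Valued.v ϖ ^ ℓ ∧ Valued.v (e' 2) ≤ Valued.v ϖ ^ ℓ) ∧
          Valued.v (e' 1 - e' 0) ≤ Valued.v ϖ ^ (ℓ + ρ) ∧ Valued.v (e' 2 - e' 1) ≤ Valued.v ϖ ^ (ℓ + ρ + s) ∧
            (Valued.v (e' 2 - e' 1) ≤ Valued.v ϖ ^ (ℓ + 2 * ρ + s) ∧ Valued.v (e' 2 - e' 0) * Valued.v ϖ ^ s ≤ Valued.v ϖ ^ (ℓ + 2 * ρ + s))) then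
        ((if 2 ∣ s ∧ 2 * ρ ≤ min n₂' n₃' ∧ 2 * ρ + s ≤ n₁' then
            (![(normSign σ (-1 : K) : ℚ) * (Fintype.card 𝓀[K] : ℚ) ^ (2 * ρ + s / 2 - 1) *
                ((if 2 * d ≤ s then (Fintype.card 𝓀[K] : ℚ) - 1 else 0) - (if s + 2 = 2 * d then 1 else 0)), 0, 0] : Fin 3 → ℚ) j
          else 0) +
        (if 2 ∣ s ∧ n₂' = n₃' ∧ n₁' = n₂' + s ∧ n₂' < 2 * ρ ∧ 2 * ρ - n₂' ≤ n₂' - d + 1 then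
            (![if 2 * d ≤ s + 2 * ((2 * ρ - n₂' + 1) / 2) then (normSign σ (-1 : K) : ℚ) * normSign σ (1 + f) else 0,
               if d ≤ (2 * ρ - n₂' + 1) / 2 then (normSign σ (-1 : K) : ℚ) * normSign σ f * normSign σ (1 + f) else 0,
               if d ≤ (2 * ρ - n₂' + 1) / 2 then (normSign σ f : ℚ) else 0] : Fin 3 → ℚ) j *
              (Fintype.card 𝓀[K] : ℚ) ^ (2 * ρ + s / 2 - (2 * ρ - n₂' + 1) / 2)
          else 0))
      else 0)
    (fun T' e' hE' hT' hHyp j =>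
      finsum_kappaCount_mul_stabiliserWeight_stratum_G1_sep_latticeInLevel_of_ne hD h2 hE' hN₀ hT' ρ s hρ hs j f hf hHyp.1 ℓ e' hHyp.2)
    e ⟨hglue, hne⟩ i
  rw [key]
  simp only [vec3_swap01, Matrix.cons_val_zero, Matrix.cons_val_one, Matrix.cons_val_two, Matrix.head_cons, Matrix.tail_cons]

/-- **LABELLED κ-G3 `(2ρ+s, 2ρ+s, 2ρ)` OFF THE CANCELLATION LOCUS** (`ρ, s ≥ 1`; a σ-fixed glue witness `f` of foot 2 as in ★ `finsum_kappaCount_mul_stabiliserWeight_hasAxis_G3`;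
`|e₀ − e₁| ≠ |e₀ − e₂|·|ϖ|^s`): the ★ unlabelled κ-G3 closed form if the rotated constant label condition
`(|e₂|, |e₁|, |e₀| ≤ |ϖ|^ℓ) ∧ |e₁ − e₂| ≤ |ϖ|^{ℓ+ρ} ∧ |e₀ − e₁| ≤ |ϖ|^{ℓ+ρ+s} ∧ (|e₀ − e₁| ≤ |ϖ|^{ℓ+2ρ+s} ∧ |e₀ − e₂|·|ϖ|^s ≤ |ϖ|^{ℓ+2ρ+s})` holds, else `0` — ★ p859787
`…_stratum_G3_sep_latticeInLevel_of_G1` ∘ ★ p859714 G1 (`(βα⁻¹−1)∕(α⁻¹−1) = (β−α)∕(1−α)` as in ★ `…hasAxis_G3`). [cite: Kottwitz1986BaseChangeUnits, §1 pp. 240–241]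
[cite: Rogawski1990, §4.9 Prop. 4.9.1 (a) p. 55; §4.10 p. 58] [cite: LanglandsShelstad1987, §3] -/
theorem finsum_kappaCount_mul_stabiliserWeight_stratum_G3_sep_latticeInLevel_of_ne (hD : IsRamifiedQuadraticDatum σ ϖ d t) (h2 : Valued.v (2 : K) < 1)
    (hE : IsElementDatum σ ϖ N₀ α β n₁ n₂ n₃) (hN₀ : d ≤ N₀) (hT : (T : Matrix (Fin 3) (Fin 3) K) = Matrix.diagonal ![α, β, 1])
    (ρ s : ℕ) (hρ : 1 ≤ ρ) (hs : 1 ≤ s) (i : Fin 3) (f : K) (hf : σ f = f)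
    (hglue : 2 ∣ s → n₂ = n₁ → n₃ = n₂ + s → n₂ < 2 * ρ → 2 * ρ - n₂ ≤ n₂ - d + 1 → Valued.v (f + (β - α) / (1 - α)) ≤ Valued.v ϖ ^ (2 * ρ + s - n₂))
    (ℓ : ℕ) (e : Fin 3 → K) (hne : Valued.v (e 0 - e 1) ≠ Valued.v (e 0 - e 2) * Valued.v ϖ ^ s) :
    ∑ᶠ M ∈ {M | M ∈ stratum σ ϖ T ![2 * ρ + s, 2 * ρ + s, 2 * ρ] ∧ LatticeInLevel ϖ ℓ (Matrix.diagonal e) M},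
        (kappaCount σ ϖ 0 i M : ℚ) * stabiliserWeight σ M =
      if ((Valued.v (e 2) ≤ Valued.v ϖ ^ ℓ ∧ Valued.v (e 1) ≤ Valued.v ϖ ^ ℓ ∧ Valued.v (e 0) ≤ Valued.v ϖ ^ ℓ) ∧
          Valued.v (e 1 - e 2) ≤ Valued.v ϖ ^ (ℓ + ρ) ∧ Valued.v (e 0 - e 1) ≤ Valued.v ϖ ^ (ℓ + ρ + s) ∧
            (Valued.v (e 0 - e 1) ≤ Valued.v ϖ ^ (ℓ + 2 * ρ + s) ∧ Valued.v (e 0 - e 2) * Valued.v ϖ ^ s ≤ Valued.v ϖ ^ (ℓ + 2 * ρ + s))) then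
        ((if 2 ∣ s ∧ 2 * ρ ≤ min n₂ n₁ ∧ 2 * ρ + s ≤ n₃ then
            (![0, 0, (normSign σ (-1 : K) : ℚ) * (Fintype.card 𝓀[K] : ℚ) ^ (2 * ρ + s / 2 - 1) *
                ((if 2 * d ≤ s then (Fintype.card 𝓀[K] : ℚ) - 1 else 0) - (if s + 2 = 2 * d then 1 else 0))] : Fin 3 → ℚ) i
          else 0) +
        (if 2 ∣ s ∧ n₂ = n₁ ∧ n₃ = n₂ + s ∧ n₂ < 2 * ρ ∧ 2 * ρ - n₂ ≤ n₂ - d + 1 then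
            (![if d ≤ (2 * ρ - n₂ + 1) / 2 then (normSign σ f : ℚ) else 0,
               if d ≤ (2 * ρ - n₂ + 1) / 2 then (normSign σ (-1 : K) : ℚ) * normSign σ f * normSign σ (1 + f) else 0,
               if 2 * d ≤ s + 2 * ((2 * ρ - n₂ + 1) / 2) then (normSign σ (-1 : K) : ℚ) * normSign σ (1 + f) else 0] : Fin 3 → ℚ) i *
              (Fintype.card 𝓀[K] : ℚ) ^ (2 * ρ + s / 2 - (2 * ρ - n₂ + 1) / 2)
          else 0))
      else 0 := by
  have hvσ : ∀ a, Valued.v (σ a) = Valued.v a := hD.2.1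
  -- the glue unit of the rescaled datum: `(βα⁻¹ − 1)∕(α⁻¹ − 1) = (β − α)∕(1 − α)` (as in ★ `…hasAxis_G3`)
  have hα : α * σ α = 1 := hE.1
  have hα0 : α ≠ 0 := fun h => by rw [h, zero_mul] at hα; exact zero_ne_one hα
  have hα1 : α ≠ 1 := hE.2.2.2.1
  have hfrac : (β * α⁻¹ - 1) / (α⁻¹ - 1) = (β - α) / (1 - α) := by
    have h1α : (1 : K) - α ≠ 0 := sub_ne_zero.2 (Ne.symm hα1)
    have hi : α⁻¹ - 1 = (1 - α) * α⁻¹ := by field_simp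
    have hn : β * α⁻¹ - 1 = (β - α) * α⁻¹ := by field_simp
    rw [hi, hn, mul_div_mul_right _ _ (inv_ne_zero hα0)]
  have key := finsum_kappaCount_mul_stabiliserWeight_stratum_G3_sep_latticeInLevel_of_G1 hvσ hE hT ρ s ℓ
    (fun α' β' n₁' n₂' n₃' e' => (2 ∣ s → n₂' = n₃' → n₁' = n₂' + s → n₂' < 2 * ρ → 2 * ρ - n₂' ≤ n₂' - d + 1 →
        Valued.v (f + (β' - 1) / (α' - 1)) ≤ Valued.v ϖ ^ (2 * ρ + s - n₂')) ∧
      Valued.v (e' 2 - e' 1) ≠ Valued.v (e' 2 - e' 0) * Valued.v ϖ ^ s)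
    (fun _ _ n₁' n₂' n₃' e' j =>
      if ((Valued.v (e' 0) ≤ Valued.v ϖ ^ ℓ ∧ Valued.v (e' 1) ≤ Valued.v ϖ ^ ℓ ∧ Valued.v (e' 2) ≤ Valued.v ϖ ^ ℓ) ∧
          Valued.v (e' 1 - e' 0) ≤ Valued.v ϖ ^ (ℓ + ρ) ∧ Valued.v (e' 2 - e' 1) ≤ Valued.v ϖ ^ (ℓ + ρ + s) ∧
            (Valued.v (e' 2 - e' 1) ≤ Valued.v ϖ ^ (ℓ + 2 * ρ + s) ∧ Valued.v (e' 2 - e' 0) * Valued.v ϖ ^ s ≤ Valued.v ϖ ^ (ℓ + 2 * ρ + s))) then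
        ((if 2 ∣ s ∧ 2 * ρ ≤ min n₂' n₃' ∧ 2 * ρ + s ≤ n₁' then
            (![(normSign σ (-1 : K) : ℚ) * (Fintype.card 𝓀[K] : ℚ) ^ (2 * ρ + s / 2 - 1) *
                ((if 2 * d ≤ s then (Fintype.card 𝓀[K] : ℚ) - 1 else 0) - (if s + 2 = 2 * d then 1 else 0)), 0, 0] : Fin 3 → ℚ) j
          else 0) +
        (if 2 ∣ s ∧ n₂' = n₃' ∧ n₁' = n₂' + s ∧ n₂' < 2 * ρ ∧ 2 * ρ - n₂' ≤ n₂' - d + 1 then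
            (![if 2 * d ≤ s + 2 * ((2 * ρ - n₂' + 1) / 2) then (normSign σ (-1 : K) : ℚ) * normSign σ (1 + f) else 0,
               if d ≤ (2 * ρ - n₂' + 1) / 2 then (normSign σ (-1 : K) : ℚ) * normSign σ f * normSign σ (1 + f) else 0,
               if d ≤ (2 * ρ - n₂' + 1) / 2 then (normSign σ f : ℚ) else 0] : Fin 3 → ℚ) j *
              (Fintype.card 𝓀[K] : ℚ) ^ (2 * ρ + s / 2 - (2 * ρ - n₂' + 1) / 2)
          else 0))
      else 0)
    (fun T' e' hE' hT' hHyp j =>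
      finsum_kappaCount_mul_stabiliserWeight_stratum_G1_sep_latticeInLevel_of_ne hD h2 hE' hN₀ hT' ρ s hρ hs j f hf hHyp.1 ℓ e' hHyp.2)
    e ⟨fun h1 h2' h3 h4 h5 => by rw [hfrac]; exact hglue h1 h2' h3 h4 h5, hne⟩ i
  rw [key]
  simp only [vec3_swap02, Matrix.cons_val_zero, Matrix.cons_val_one, Matrix.cons_val_two, Matrix.head_cons, Matrix.tail_cons]

end Summit.HodgeConjecture.HodgeConjecture.Cruxes.H413.F0P3cDyRamLabelledKappaGluedRotationsOffLocus

end
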